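import Mathlib
import Summits.CriticalPhenomena.Ising3DConformalLimit.Theorems.PrecisionLaplacianEtaBoundsTransferPackage
import HarnessLib

/-!
# TwoPointSpineGlue (route PrecisionLaplacian, item stmt-CriticalPhenomena-4805) — the Green package
# under positivity of ONE direct-correlation coefficient

Helper file 3 for the proof of
`Summit.CriticalPhenomena.Ising3DConformalLimit.Theses.PrecisionLaplacian.TwoPointSpineGlue`.
The potential-theory chain of the `EtaBoundsTransfer` helper files (`…EtaBoundsTransferPotential`,
`…Limit`, `…Equation`, `…Green`, `…Package`) derives, from the symmetric-potential hypothesis on the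
critical kernel `G = criticalTwoPoint 3` alone, the infinite-volume equation `A₀ G − a ∗ G = δ` for the
direct correlation function `a ≥ 0` (even, summable, `∑ a ≤ A₀`).  The two remaining steps there — the
Green-function representation and the absence of killing `∑ a = A₀` (from `χ(β_c) = ∞`) — were proved
under `a > 0` everywhere off the origin (a by-product of the two-sided tail bounds of that item).  Under
the hypotheses of `TwoPointSpineGlue` only an asymptotic profile `Φ ≥ 0, Φ ≢ 0` is available, which gives
`a(y₀) > 0` for ONE site `y₀ ≠ 0` (indeed for all far sites of an open cone).  This file re-proves the
maximum principle in that generality (`harmonic_eq_zero_of_pos`: a nonnegative `q`-harmonic function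
vanishing at infinity is zero as soon as `q(y₀) > 0` for one step `y₀` of infinite order — iterate the
step from a maximum point), and repackages the chain as `green_package_of_pos`: `A₀ > 0`, the even step
weights `b = 𝟙_{≠0} a` with `HasSum b A₀`, and the renewal (Ornstein–Zernike) identity
`G = A₀⁻¹ δ₀ + (b/A₀) ∗ G`.  No definitions are introduced.

References: C. Dellacherie, S. Martínez, J. San Martín, *Inverse M-matrices and ultrametric matrices*,
LNM 2118 (2014), ch. 2–3; G. Lawler, V. Limic, *Random Walk: A Modern Introduction* (2010), §4.
-/

noncomputable section

namespace Summit.CriticalPhenomena.Ising3DConformalLimit.Theorems.SpineGlue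

open Filter Topology Finset
open scoped ENNReal
open Literature.Probability.LatticeModels
open Summit.CriticalPhenomena.Ising3DConformalLimit.Theorems.EtaBoundsTransfer

section MaxPrinciple

variable {X : Type*} [AddCommGroup X]

/-- One step of the maximum principle: at a maximum point `x` of a nonnegative `q`-harmonic
function (`∑ q ≤ 1`), `h (x - y₀) = h x` for every step `y₀` with `q y₀ > 0`. -/
theorem harmonic_max_step {h q : X → ℝ} (hq0 : ∀ y, 0 ≤ q y) {y₀ : X} (hy₀ : 0 < q y₀)
    (hqs : Summable q) (hq1 : ∑' y, q y ≤ 1) (hh0 : ∀ z, 0 ≤ h z)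
    (hsum : ∀ z, Summable (fun y => q y * h (z - y)))
    (hharm : ∀ z, h z = ∑' y, q y * h (z - y)) {x : X} (hle : ∀ z, h z ≤ h x) :
    h (x - y₀) = h x := by
  have hdiff_summ : Summable (fun y => q y * (h x - h (x - y))) := by
    have : (fun y => q y * (h x - h (x - y))) = fun y => q y * h x - q y * h (x - y) := by
      funext y; ring
    rw [this]
    exact (hqs.mul_right _).sub (hsum x)
  have hdiff_nn : ∀ y, 0 ≤ q y * (h x - h (x - y)) :=
    fun y => mul_nonneg (hq0 y) (by linarith [hle (x - y)])
  have hdiff_le : ∑' y, q y * (h x - h (x - y)) ≤ 0 := by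
    have h1 : ∑' y, q y * (h x - h (x - y)) = (∑' y, q y) * h x - h x := by
      rw [show (fun y => q y * (h x - h (x - y))) = fun y => q y * h x - q y * h (x - y) from
        funext fun y => by ring]
      rw [(hqs.mul_right _).tsum_sub (hsum x), tsum_mul_right, ← hharm x]
    rw [h1]
    nlinarith [hh0 x]
  have hzero : (fun y => q y * (h x - h (x - y))) = 0 := by
    have h0 : ∑' y, q y * (h x - h (x - y)) = 0 := le_antisymm hdiff_le (tsum_nonneg hdiff_nn)
    have := hdiff_summ.hasSum
    rw [h0] at this
    exact (hasSum_zero_iff_of_nonneg hdiff_nn).1 this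
  have := congr_fun hzero y₀
  simp only [Pi.zero_apply, mul_eq_zero] at this
  rcases this with h1 | h1
  · exact absurd h1 hy₀.ne'
  · linarith

/-- **Maximum principle**: a nonnegative `q`-harmonic function (`q ≥ 0`, `∑ q ≤ 1`) tending to `0`
at infinity vanishes, as soon as `q y₀ > 0` for one step `y₀` of infinite order (iterate
`harmonic_max_step` from a maximum point: the maximum is attained along `x₀ - n • y₀`, an infinite
set, contradicting `h → 0`). -/
theorem harmonic_eq_zero_of_pos {h q : X → ℝ} (hq0 : ∀ y, 0 ≤ q y) {y₀ : X} (hy₀ : 0 < q y₀)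
    (hinj : Function.Injective fun n : ℕ => n • y₀)
    (hqs : Summable q) (hq1 : ∑' y, q y ≤ 1)
    (hh0 : ∀ z, 0 ≤ h z) (hhto : Tendsto h cofinite (𝓝 0))
    (hsum : ∀ z, Summable (fun y => q y * h (z - y)))
    (hharm : ∀ z, h z = ∑' y, q y * h (z - y)) : ∀ z, h z = 0 := by
  by_contra hne
  push Not at hne
  obtain ⟨x₁, hx₁⟩ := hne
  have hx₁pos : 0 < h x₁ := lt_of_le_of_ne (hh0 x₁) (Ne.symm hx₁)
  -- the finite set where `h ≥ h x₁`
  have hfin : {z | h x₁ ≤ h z}.Finite := by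
    have hev : ∀ᶠ z in cofinite, h z < h x₁ := hhto.eventually (gt_mem_nhds hx₁pos)
    have := Filter.eventually_cofinite.1 hev
    simpa [not_lt] using this
  have hx₁F : x₁ ∈ hfin.toFinset := hfin.mem_toFinset.2 (show h x₁ ≤ h x₁ from le_rfl)
  obtain ⟨x₀, hx₀F, hmax⟩ := Finset.exists_max_image hfin.toFinset h ⟨x₁, hx₁F⟩
  have hx₀ge : h x₁ ≤ h x₀ := hfin.mem_toFinset.1 hx₀F
  have hle : ∀ z, h z ≤ h x₀ := by
    intro z
    by_cases hz : h x₁ ≤ h z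
    · exact hmax z (hfin.mem_toFinset.2 hz)
    · exact (le_of_lt (not_le.1 hz)).trans hx₀ge
  -- the maximum propagates along `x₀ - n • y₀`
  have hprop : ∀ n : ℕ, h (x₀ - n • y₀) = h x₀ := by
    intro n
    induction n with
    | zero => simp
    | succ n ih =>
      have hle' : ∀ z, h z ≤ h (x₀ - n • y₀) := fun z => by rw [ih]; exact hle z
      have := harmonic_max_step hq0 hy₀ hqs hq1 hh0 hsum hharm hle'
      rw [succ_nsmul, ← sub_sub, this, ih]
  -- an infinite subset of a finite set
  have hsub : Set.range (fun n : ℕ => x₀ - n • y₀) ⊆ {z | h x₁ ≤ h z} := by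
    rintro _ ⟨n, rfl⟩
    show h x₁ ≤ h (x₀ - n • y₀)
    rw [hprop n]
    exact hx₀ge
  have hinj' : Function.Injective fun n : ℕ => x₀ - n • y₀ := fun n m hnm => by
    apply hinj
    have : x₀ - n • y₀ = x₀ - m • y₀ := hnm
    simpa using this
  exact (Set.infinite_range_of_injective hinj').mono hsub |>.not_finite (hfin)

end MaxPrinciple

section Green

variable {X : Type*} [AddCommGroup X] [DecidableEq X]
  {G : X → ℝ} {b : X → ℝ} {A₀ : ℝ} {Q : ℕ → X → ℝ≥0∞}

/-- **Green-function representation** `G(z) = A₀⁻¹ ∑_n Q n z` (in `ℝ≥0∞`) under positivity of one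
coefficient `b y₀ > 0` of infinite order: `G − v` is a nonnegative `q`-harmonic function tending
to `0`, hence vanishes (`harmonic_eq_zero_of_pos`). -/
theorem green_repr_of_pos (hG0 : ∀ x, 0 ≤ G x) (hGle : ∀ x, G x ≤ G 0)
    (hGto : Tendsto G cofinite (𝓝 0)) (hb0 : ∀ y, 0 ≤ b y) {y₀ : X} (hy₀ : 0 < b y₀)
    (hinj : Function.Injective fun n : ℕ => n • y₀)
    (hbs : Summable b) (hA0 : 0 < A₀) (hbA : ∑' y, b y ≤ A₀)
    (heq : ∀ z, A₀ * G z - ∑' y, b y * G (z - y) = if z = 0 then 1 else 0)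
    (hQ0 : ∀ z, Q 0 z = if z = 0 then 1 else 0)
    (hQs : ∀ n z, Q (n + 1) z = ∑' y, ENNReal.ofReal (b y / A₀) * Q n (z - y)) (z : X) :
    ENNReal.ofReal (G z) = (ENNReal.ofReal A₀)⁻¹ * ∑' n, Q n z := by
  set v : X → ℝ≥0∞ := fun w => (ENNReal.ofReal A₀)⁻¹ * ∑' n, Q n w with hv
  have hvle : ∀ w, v w ≤ ENNReal.ofReal (G w) := fun w => green_le hG0 hGle hb0 hbs hA0 heq hQ0 hQs w
  have hvfin : ∀ w, v w ≠ ∞ := fun w => ne_top_of_le_ne_top ENNReal.ofReal_ne_top (hvle w)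
  set vr : X → ℝ := fun w => (v w).toReal with hvr
  have hvr_le : ∀ w, vr w ≤ G w := fun w => ENNReal.toReal_le_of_le_ofReal (hG0 w) (hvle w)
  have hvr_nn : ∀ w, 0 ≤ vr w := fun w => ENNReal.toReal_nonneg
  set hr : X → ℝ := fun w => G w - vr w with hhr
  have hq0 : ∀ y, 0 ≤ b y / A₀ := fun y => div_nonneg (hb0 y) hA0.le
  have hsumG := summable_q_mul hG0 hGle hb0 hbs hA0
  have hsumv : ∀ w, Summable (fun y => (b y / A₀) * vr (w - y)) := fun w =>
    Summable.of_nonneg_of_le (fun y => mul_nonneg (hq0 y) (hvr_nn _))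
      (fun y => mul_le_mul_of_nonneg_left (hvr_le _) (hq0 y)) (hsumG w)
  have hsumh : ∀ w, Summable (fun y => (b y / A₀) * hr (w - y)) := by
    intro w
    have : (fun y => (b y / A₀) * hr (w - y)) =
        fun y => (b y / A₀) * G (w - y) - (b y / A₀) * vr (w - y) := by
      funext y; simp only [hhr]; ring
    rw [this]; exact (hsumG w).sub (hsumv w)
  have hharm : ∀ w, hr w = ∑' y, (b y / A₀) * hr (w - y) := by
    intro w
    have e1 := real_equation hG0 hGle hb0 hbs hA0 heq w
    have e2 := green_equation_real hG0 hGle hb0 hbs hA0 heq hQ0 hQs w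
    have : (fun y => (b y / A₀) * hr (w - y)) =
        fun y => (b y / A₀) * G (w - y) - (b y / A₀) * vr (w - y) := by
      funext y; simp only [hhr]; ring
    rw [this, (hsumG w).tsum_sub (hsumv w)]
    simp only [hhr, hvr, hv]
    rw [e2]
    linarith [e1]
  have hhto : Tendsto hr cofinite (𝓝 0) := by
    apply tendsto_of_tendsto_of_tendsto_of_le_of_le tendsto_const_nhds hGto
    · intro w; simp only [hhr]; linarith [hvr_le w]
    · intro w; simp only [hhr]; linarith [hvr_nn w]
  have hq1 : ∑' y, b y / A₀ ≤ 1 := by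
    rw [tsum_div_const]; exact (div_le_one hA0).2 hbA
  have hzero := harmonic_eq_zero_of_pos hq0 (div_pos hy₀ hA0) hinj (hbs.div_const A₀) hq1
    (fun w => by simp only [hhr]; linarith [hvr_le w]) hhto hsumh hharm z
  have hGv : G z = vr z := by simp only [hhr] at hzero; linarith
  rw [hGv, hvr]
  exact ENNReal.ofReal_toReal (hvfin z)

/-- **No killing at criticality** (`κ = 0`) under positivity of one coefficient: if `G` is not
summable then `∑ b = A₀`, i.e. the step law `q = b / A₀` is a probability (otherwise the Green
series has finite total mass `A₀⁻¹ (1 − ρ)⁻¹`). -/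
theorem tsum_b_eq_of_pos [Infinite X] (hG0 : ∀ x, 0 ≤ G x) (hGle : ∀ x, G x ≤ G 0)
    (hGto : Tendsto G cofinite (𝓝 0)) (hGns : ¬ Summable G)
    (hb0 : ∀ y, 0 ≤ b y) {y₀ : X} (hy₀ : 0 < b y₀)
    (hinj : Function.Injective fun n : ℕ => n • y₀)
    (hbs : Summable b) (hA0 : 0 < A₀) (hbA : ∑' y, b y ≤ A₀)
    (heq : ∀ z, A₀ * G z - ∑' y, b y * G (z - y) = if z = 0 then 1 else 0)
    (hQ0 : ∀ z, Q 0 z = if z = 0 then 1 else 0)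
    (hQs : ∀ n z, Q (n + 1) z = ∑' y, ENNReal.ofReal (b y / A₀) * Q n (z - y)) :
    ∑' y, b y = A₀ := by
  by_contra hne
  have hlt : ∑' y, b y < A₀ := lt_of_le_of_ne hbA hne
  set ρ := ENNReal.ofReal ((∑' y, b y) / A₀) with hρ
  have hρ1 : ρ < 1 := by
    rw [hρ, ← ENNReal.ofReal_one]
    exact (ENNReal.ofReal_lt_ofReal_iff zero_lt_one).2 ((div_lt_one hA0).2 hlt)
  have htot : ∑' z, ENNReal.ofReal (G z) = (ENNReal.ofReal A₀)⁻¹ * (1 - ρ)⁻¹ := by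
    simp_rw [green_repr_of_pos hG0 hGle hGto hb0 hy₀ hinj hbs hA0 hbA heq hQ0 hQs]
    rw [ENNReal.tsum_mul_left, ENNReal.tsum_comm]
    simp_rw [tsum_Q_eq_pow hb0 hbs hA0 hQ0 hQs]
    rw [ENNReal.tsum_geometric]
  have hfin : ∑' z, ENNReal.ofReal (G z) ≠ ∞ := by
    rw [htot]
    exact ENNReal.mul_ne_top (ENNReal.inv_ne_top.2 (by simp [hA0]))
      (ENNReal.inv_ne_top.2 (tsub_pos_of_lt hρ1).ne')
  apply hGns
  have hs := ENNReal.summable_toReal hfin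
  refine hs.congr fun z => ?_
  exact ENNReal.toReal_ofReal (hG0 z)

end Green

section Package

/-- Nonzero lattice sites have infinite order: `n ↦ n • y₀` is injective for `y₀ ≠ 0` in `ℤᵈ`. -/
theorem nsmul_injective_of_ne_zero {d : ℕ} {y₀ : Site d} (hy : y₀ ≠ 0) :
    Function.Injective fun n : ℕ => n • y₀ := by
  obtain ⟨i, hi⟩ : ∃ i, y₀ i ≠ 0 := by
    by_contra h
    push Not at h
    exact hy (funext h)
  intro n m hnm
  have h1 : (n • y₀) i = (m • y₀) i := by rw [show (n • y₀) = (m • y₀) from hnm]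
  simp only [Pi.smul_apply, nsmul_eq_mul] at h1
  exact_mod_cast mul_right_cancel₀ hi h1

/-- **The Green package under positivity of one coefficient.** Under the symmetric-potential
hypothesis for `G = criticalTwoPoint 3` and `a(y₀) > 0` for one site `y₀ ≠ 0` of the direct
correlation function `a(y) = inf_A −(G_A⁻¹)(0,y)`, there are `A₀ > 0` and the even, nonnegative step
weights `b = 𝟙_{≠0} a` with `HasSum b A₀` (no killing: `χ(β_c) = ∞`) satisfying the renewal
(Ornstein–Zernike) identity `G(z) = A₀⁻¹ δ_{z,0} + ∑_y (b y / A₀) G(z − y)`; moreover `0 ≤ G ≤ G 0`. -/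
theorem green_package_of_pos
    (hSP : ∀ A : Finset (Site 3), (Matrix.of fun (p q : ↥A) => criticalTwoPoint 3 (q.1 - p.1)).PosDef ∧
      ∀ u v : ↥A, (u ≠ v → (Matrix.of fun (p q : ↥A) => criticalTwoPoint 3 (q.1 - p.1))⁻¹ u v ≤ 0) ∧
        0 ≤ ∑ w, (Matrix.of fun (p q : ↥A) => criticalTwoPoint 3 (q.1 - p.1))⁻¹ u w)
    {y₀ : Site 3} (hy₀0 : y₀ ≠ 0)
    (hy₀ : 0 < ⨅ A : {A : Finset (Site 3) // (0 : Site 3) ∈ A ∧ y₀ ∈ A},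
        -((Matrix.of fun (p q : ↥A.1) => criticalTwoPoint 3 (q.1 - p.1))⁻¹ ⟨0, A.2.1⟩ ⟨y₀, A.2.2⟩)) :
    ∃ (A₀ : ℝ) (b : Site 3 → ℝ),
      0 < A₀ ∧ (∀ y, 0 ≤ b y) ∧ Summable b ∧ (∀ y, b (-y) = b y) ∧ HasSum b A₀ ∧ b 0 = 0 ∧
      (∀ y, y ≠ 0 → b y = ⨅ A : {A : Finset (Site 3) // (0 : Site 3) ∈ A ∧ y ∈ A},
        -((Matrix.of fun (p q : ↥A.1) => criticalTwoPoint 3 (q.1 - p.1))⁻¹ ⟨0, A.2.1⟩ ⟨y, A.2.2⟩)) ∧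
      (∀ z, criticalTwoPoint 3 z =
        A₀⁻¹ * (if z = 0 then 1 else 0) + ∑' y, (b y / A₀) * criticalTwoPoint 3 (z - y)) ∧
      (∀ z, 0 ≤ criticalTwoPoint 3 z) ∧ (∀ z, criticalTwoPoint 3 z ≤ criticalTwoPoint 3 0) := by
  haveI := infinite_site_three
  set G : Site 3 → ℝ := criticalTwoPoint 3 with hG
  set M : (A : Finset (Site 3)) → Matrix A A ℝ := fun A => Matrix.of fun (p q : ↥A) => G (q.1 - p.1)
    with hMdef
  have hM : ∀ A, M A = Matrix.of fun (p q : ↥A) => G (q.1 - p.1) := fun A => rfl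
  have hSP' : ∀ A : Finset (Site 3), (M A).PosDef ∧
      ∀ u v : ↥A, (u ≠ v → (M A)⁻¹ u v ≤ 0) ∧ 0 ≤ ∑ w, (M A)⁻¹ u w := hSP
  set a : Site 3 → ℝ := fun y => ⨅ A : {A : Finset (Site 3) // (0 : Site 3) ∈ A ∧ y ∈ A},
    -((M A.1)⁻¹ ⟨0, A.2.1⟩ ⟨y, A.2.2⟩) with hadef
  have ha : ∀ y, a y = ⨅ A : {A : Finset (Site 3) // (0 : Site 3) ∈ A ∧ y ∈ A},
      -((M A.1)⁻¹ ⟨0, A.2.1⟩ ⟨y, A.2.2⟩) := fun y => rfl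
  have hay₀ : 0 < a y₀ := hy₀
  set k : ℕ → ℝ := fun n => (M (box 3 n))⁻¹ ⟨0, zero_mem_box 3 n⟩ ⟨0, zero_mem_box 3 n⟩ with hkdef
  have hk : ∀ n, k n = (M (box 3 n))⁻¹ ⟨0, zero_mem_box 3 n⟩ ⟨0, zero_mem_box 3 n⟩ := fun n => rfl
  set t : ℕ → Site 3 → ℝ := fun n y => if hy : y ∈ box 3 n then
    -(M (box 3 n))⁻¹ ⟨0, zero_mem_box 3 n⟩ ⟨y, hy⟩ else 0 with htdef
  have ht : ∀ n y (hy : y ∈ box 3 n), t n y = -(M (box 3 n))⁻¹ ⟨0, zero_mem_box 3 n⟩ ⟨y, hy⟩ := by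
    intro n y hy; simp only [htdef, dif_pos hy]
  -- facts about `G`
  have hGto : Tendsto G cofinite (𝓝 0) := criticalTwoPoint_tendsto_zero_cofinite
  have hGns : ¬ Summable G := criticalTwoPoint_not_summable
  have hGnn : ∀ x, 0 ≤ G x := apply_nonneg hM hSP'
  have hGle : ∀ x, G x ≤ G 0 := fun x => by
    by_cases hx : x = 0
    · rw [hx]
    · exact (apply_lt_apply_zero hM hSP' hx).le
  -- the potential-theory chain
  obtain ⟨A₀, hkA, hkle, hA0⟩ := exists_A0 hM hSP' hGto hk
  obtain ⟨hsa, hsa_le⟩ := summable_a hSP' hk ht ha hkle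
  have heq := limit_equation hM hSP' hGto hk ht ha hkA hkle
  set b : Site 3 → ℝ := fun y => if y = 0 then 0 else a y with hbdef
  have hb0 : ∀ y, 0 ≤ b y := fun y => by
    simp only [hbdef]; split_ifs with h
    · exact le_rfl
    · exact a_nonneg hSP' ha h
  have hbev : ∀ y, b (-y) = b y := fun y => by
    by_cases hy : y = 0
    · simp [hbdef, hy]
    · simp only [hbdef, if_neg hy, if_neg (neg_ne_zero.2 hy)]
      exact a_neg hM hSP' ht ha hy
  have hby₀ : 0 < b y₀ := by simp only [hbdef, if_neg hy₀0]; exact hay₀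
  have hinj := nsmul_injective_of_ne_zero hy₀0
  -- convolution powers in `ℝ≥0∞`
  set Q : ℕ → Site 3 → ℝ≥0∞ := fun n => Nat.rec (fun z => if z = 0 then 1 else 0)
    (fun _ Qn z => ∑' y, ENNReal.ofReal (b y / A₀) * Qn (z - y)) n with hQdef
  have hQ0 : ∀ z, Q 0 z = if z = 0 then 1 else 0 := fun z => rfl
  have hQs : ∀ n z, Q (n + 1) z = ∑' y, ENNReal.ofReal (b y / A₀) * Q n (z - y) := fun n z => rfl
  have hbA : ∑' y, b y = A₀ :=
    tsum_b_eq_of_pos hGnn hGle hGto hGns hb0 hby₀ hinj hsa hA0 hsa_le heq hQ0 hQs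
  refine ⟨A₀, b, hA0, hb0, hsa, hbev, ?_, by simp [hbdef], ?_, ?_, hGnn, hGle⟩
  · rw [← hbA]; exact hsa.hasSum
  · intro y hy; simp only [hbdef, if_neg hy]; exact ha y
  · intro z
    exact real_equation hGnn hGle hb0 hsa hA0 heq z

end Package

end Summit.CriticalPhenomena.Ising3DConformalLimit.Theorems.SpineGlue

end
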